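import Literature.AlgebraicGeometry.HodgeTheory.ComplexTorusCartierDivisorChernCharacter
import Literature.AlgebraicGeometry.HodgeTheory.ComplexTorusNeronSeveriFormCupExpansion
import Literature.AlgebraicGeometry.Motives.PeriodRealizationClassical

/-!
# `ch₁(𝒪_A(Θ)^an) = -½ Σ_{a,b} E(λ_a, λ_b) (γ_a ⊗ 1) ⌣ (γ_b ⊗ 1)` in a lattice frame (torus Hodge model of record)

Layer `Literature/AlgebraicGeometry/HodgeTheory`; cell `hodgecm-mathlib`, rung B-I/(U), leaf (T3) file 3 = files 1 + 2 in the
shape consumed by the flat-Gram assembler (socket (R) of the P4 lead's v0.10/v0.12): for an abelian variety `A/ℂ`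
analytified by the torus `X = E/Φ(ℤ^ι)` (`φ`, `hφ`), a Cartier divisor `Θ` with Appell–Humbert datum `p = (H, χ)`
(`E = Im H`, integer Gram `G = intGram Φ E`, `G_ab = E(λ_a, λ_b)`), and ANY frame `γ : ι → H¹(A(ℂ); ℚ)` lifting the canonical
lattice classes (`φ^* γ_a = ξ_a`), the first Chern character class of `𝒪_A(Θ)` in the torus Hodge model of record
`B₀ = (E, X, φ, e₀)` is

  `B₀.chernCharacter 𝒪_A(Θ)^an 1 = -½ Σ_a Σ_b G_ab · (γ_a ⊗ 1) ⌣ (γ_b ⊗ 1) ∈ H²(A(ℂ); ℂ)`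

(`chernCharacter_cartierDivisorCocycle_hodgeModel_of_record_eq_sum_cupProduct`; order-free double sum; tree sign of
`IsChernForm`).  [Lange2023] Lemma 2.1.2 / Thm. 2.1.3 («`c₁(L) = E`» under `H²(X, ℤ) = Alt²(Λ, ℤ)`), read through the de Rham
isomorphism of record (Prop. 1.1.20).  Theorems only.

## References

* [Lange2023AbelianVarietiesComplex] H. Lange, *Abelian Varieties over the Complex Numbers* (2023), §2.1.2 Lemma 2.1.2 and
  Thm. 2.1.3, §1.1.4 Prop. 1.1.20, §1.5.1.
* [HatcherAT2002] A. Hatcher, *Algebraic Topology* (2002), §3.1 p. 198, §3.2 Prop. 3.10.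
-/

noncomputable section

-- `ComplexTorus Φ'` (for `Φ' : ℝⁿ ≃ E`) is the type `Torus n = (ℝ/ℤ)ⁿ`; instance paths up to unfolding (as in row A1-30⁺⁺)
set_option backward.isDefEq.respectTransparency false

open Literature.NumberTheory.Transcendental Literature.Geometry.Kaehler
open Literature.AlgebraicTopology.SingularHomology
open Literature.AlgebraicGeometry.Motives (ComplexPoints AbelianVariety CartierDivisor)

namespace Literature.AlgebraicGeometry.HodgeTheory

variable {ι : Type} [Fintype ι] [DecidableEq ι] {E : Type} [NormedAddCommGroup E] [NormedSpace ℂ E]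
  [FiniteDimensional ℝ E] [FiniteDimensional ℂ E] (Φ : (ι → ℝ) ≃L[ℝ] E) (A : AbelianVariety ℂ)
  (φ : C(ComplexTorus Φ, ComplexPoints A.X)) (hφ : IsAnalytification E A.X A.dim φ)

omit [Fintype ι] [DecidableEq ι] [FiniteDimensional ℝ E] [FiniteDimensional ℂ E] in
/-- Complexification of a cup square of rational degree-one classes: `(x ⌣ y) ⊗ 1 = (x ⊗ 1) ⌣ (y ⊗ 1)` for the iterated
product `m₂`. [cite: HatcherAT2002, §3.2 Prop. 3.10] -/
theorem ofRatClass_cupPowOne_two (x y : singularCohomology ℚ ℚ (ComplexPoints A.X) 1) :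
    ofRatClass (ComplexPoints A.X) 2 (cupPowOne ℚ (ComplexPoints A.X) 2 ![x, y]) =
      cupProduct (show 1 + 1 = 2 from rfl) (ofRatClass (ComplexPoints A.X) 1 x) (ofRatClass (ComplexPoints A.X) 1 y) := by
  rw [ofRatClass_eq_ringChange, ringChange_cupPowOne, cupPowOne_succ, cupPowOne_one, ofRatClass_eq_ringChange,
    ofRatClass_eq_ringChange]
  rfl

/-- **(T3, frame form) `B₀.chernCharacter 𝒪_A(Θ)^an 1 = -½ Σ_a Σ_b E(λ_a, λ_b) (γ_a ⊗ 1) ⌣ (γ_b ⊗ 1)`** in `H²(A(ℂ); ℂ)` for the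
torus Hodge model of record `B₀ = (E, X, φ, e₀)` of `A`, the Appell–Humbert datum `p` of `𝒪_A(Θ)^an` and any frame `γ` of
`H¹(A(ℂ); ℚ)` with `φ^* γ_a = ξ_a` (order-free double sum over the integer Gram matrix `intGram Φ p.form`).  Files 1 + 2:
`ch₁ = -(E₂⁻¹(E ⊗ 1)) ⊗ 1` and `E₂⁻¹(E ⊗ 1) = ½ Σ_a Σ_b G_ab (γ_a ⌣ γ_b)`, complexified (`⊗ 1` is a ring map).
[cite: Lange2023AbelianVarietiesComplex, §2.1.2 Lemma 2.1.2 and Thm. 2.1.3] [cite: HatcherAT2002, §3.1 p. 198] -/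
theorem chernCharacter_cartierDivisorCocycle_hodgeModel_of_record_eq_sum_cupProduct (Θ : CartierDivisor A.X.left)
    (p : ComplexTorus.AHData Φ)
    (hp : ComplexTorus.AHData.toPic p = ComplexTorus.picClass (cartierDivisorLineBundle hφ Θ))
    (γ : ι → singularCohomology ℚ ℚ (ComplexPoints A.X) 1)
    (hγ : ∀ a, singularCohomology.map ℚ ℚ φ 1 (γ a) = latticeClass Φ a) :
    ({ model := E, carrier := ComplexTorus Φ, toComplexPoints := φ, isAnalytification := hφ,
        deRham := (integrationDeRhamIsoFamily E).complexify, deRham_isNatural := integrationFamily_isNatural,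
        isInternal_hodgePQ := ComplexTorus.isInternal_hodgePQ Φ } : HodgeModel A.dim A.X).chernCharacter
        (cartierDivisorCocycle hφ Θ) 1 =
      -((2 : ℂ)⁻¹ • ∑ a, ∑ b, ((ComplexTorus.intGram Φ p.form a b : ℤ) : ℂ) •
        cupProduct (show 1 + 1 = 2 from rfl) (ofRatClass (ComplexPoints A.X) 1 (γ a))
          (ofRatClass (ComplexPoints A.X) 1 (γ b))) := by
  rw [chernCharacter_cartierDivisorCocycle_hodgeModel_of_record Φ A φ hφ Θ p hp,
    show (⟨ComplexTorus.ofRealForm p.form, ofRealForm_form_mem_rationalForms Φ p⟩ : ComplexTorus.rationalForms Φ 2) =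
      ⟨ComplexTorus.ofRealForm p.form, ofRealForm_mem_rationalForms_of_isNSForm Φ p.isNSForm_form⟩ from rfl,
    bettiFormsEquivDeg_symm_ofRealForm_eq_sum_cupPowOne Φ A φ hφ γ hγ p.isNSForm_form, ofRatClass_smul, map_sum]
  simp only [map_sum, ofRatClass_smul, ofRatClass_cupPowOne_two, Rat.cast_intCast, one_div, Rat.cast_inv,
    Rat.cast_ofNat]

end Literature.AlgebraicGeometry.HodgeTheory

end
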